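import Literature.NumberTheory.DiophantineGeometry.CatalanThaineGalois
import Literature.NumberTheory.DiophantineGeometry.CatalanThaineFrob
import Literature.NumberTheory.NumberFields.ClassFieldOfClassGroupCharacter
import Literature.NumberTheory.NumberFields.ClassGroupPrimesAvoiding
import Literature.NumberTheory.NumberFields.BauerSplitPrimes
import Literature.NumberTheory.GaloisRepresentations.ArtinReciprocityPerPrime
import HarnessLib

/-!
# Thaine's theorem for `ℚ(ζ_p)`, X: the auxiliary primes exist [Schoof2009, Lemma 16.2]

Assembly of [Schoof2009, Lemma 16.2] for `K = ℚ(ζ_p)`: for every non-zero ideal `𝔠` of `𝓞 K`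
there is a prime `𝔩` of `K` of prime norm `l ≡ 1 (mod pq)` in the class of `𝔠` modulo `q`-th
powers, modulo which the generator `u₀` of `E/E^q` is not a `q`-th power, while it is a `q`-th
power modulo `σ_b(𝔩)`, `b ≠ ±1` — the hypothesis `hAux` of `Catalan.Thaine.thaine` (part V).
Proof as printed (pp. 112–113): the class fields `E_ψ` of the characters of `Cl_K`
(`exists_classField_char_frobenius`) and their compositum `H'`, an element `h ∈ Gal(H'/K)` with
`χ_ψ(h) = ψ([𝔠])` (a product of Frobenius elements, `ClassGroup.mem_closure_mk0_prime_not_mem`),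
the Frobenius element `g` of part IX (Kummer theory, Teichmüller disjointness, fibre product),
Chebotarëv's density theorem (`infinite_setOf_exists_isArithFrobAt`), and the dictionary of part VI
(`auxPrime_of_isArithFrobAt`).

* `Catalan.Thaine.isArithFrobAt_autCongr` — transport of Frobenius elements along `E ≃ₐ[K] E'`;
* `Catalan.Thaine.exists_eq_sign_mul_pow` — `(ℤ/p)ˣ = ±γ^{[0, g)}` for a generator `γ`;
* `Catalan.Thaine.exists_classCompositum` — the compositum `H'` of the class fields of all
  characters of `Cl_K` (finite abelian Galois, unramified everywhere), the characters
  `V ψ = χ_ψ ∘ res` of `Gal(H'/K)` with their Frobenius values, and the Artin symbol `h` of a class;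
* `Catalan.Thaine.exists_auxPrime` — [Schoof2009, Lemma 16.2] in the form `hAux`;
* `Catalan.Thaine.thaine_main` — **Thaine's theorem** [Schoof2009, Theorem 16.3] with Lemma 16.2
  supplied: `θ` annihilating the generator `u₀` of `E/E^q` modulo cyclotomic units and `q`-th powers
  annihilates `[𝔠 · ι𝔠]` in `Cl_K/Cl_K^q` for every `𝔠` (the independence input being
  `Catalan.PUnits.indepModPowers_of_free` applied to [Schoof2009, Prop. 13.7]).

Everything is proved; no definitions.

## References

* R. Schoof, *Catalan's Conjecture*, Universitext, Springer 2009 [Schoof2009], Lemma 16.2 and its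
  proof (pp. 109, 112–113) — held, `lit read book:schoof2009-catalan-s-conjecture`
  (PDF pp. 183, 186–188).
* L. C. Washington, *Introduction to Cyclotomic Fields*, GTM 83, Springer 1997 [Washington1997],
  §15.2.
-/

noncomputable section

namespace Literature.NumberTheory.DiophantineGeometry

namespace Catalan.Thaine

open Polynomial IntermediateField _root_.NumberField IsDedekindDomain
open Literature.NumberTheory.NumberFields Literature.NumberTheory.GaloisRepresentations

/-! ### Transport of Frobenius elements along isomorphisms of fields -/

section Transport

variable {K E E' : Type*} [Field K] [Field E] [Field E'] [Algebra K E] [Algebra K E']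

/-- the contraction to `𝓞 K` is unchanged by transport along `𝓞 E ≃ 𝓞 E'`. [folklore] -/
theorem under_map_mapAlgEquiv (e : E ≃ₐ[K] E') (Q : Ideal (𝓞 E)) :
    (Q.map (RingOfIntegers.mapAlgEquiv e)).under (𝓞 K) = Q.under (𝓞 K) := by
  ext x
  rw [Ideal.under_def, Ideal.under_def, Ideal.mem_comap, Ideal.mem_comap,
    Ideal.mem_map_iff_of_surjective _ (RingOfIntegers.mapAlgEquiv e).surjective]
  constructor
  · rintro ⟨y, hy, hyx⟩
    have : y = algebraMap (𝓞 K) (𝓞 E) x := by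
      apply (RingOfIntegers.mapAlgEquiv e).injective
      rw [hyx, AlgEquiv.commutes]
    rw [← this]; exact hy
  · intro hx
    exact ⟨_, hx, AlgEquiv.commutes _ x⟩

/-- **Frobenius elements transport along `E ≃ₐ[K] E'`**: if `φ` is an arithmetic Frobenius at
`Q ⊂ 𝓞 E` then `e φ e⁻¹` is one at `e(Q) ⊂ 𝓞 E'`. [folklore] -/
theorem isArithFrobAt_autCongr (e : E ≃ₐ[K] E') {φ : E ≃ₐ[K] E} {Q : Ideal (𝓞 E)}
    (h : IsArithFrobAt (𝓞 K) φ Q) :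
    IsArithFrobAt (𝓞 K) (AlgEquiv.autCongr e φ) (Q.map (RingOfIntegers.mapAlgEquiv e)) := by
  set f := RingOfIntegers.mapAlgEquiv e with hf
  intro x'
  rw [MulSemiringAction.toAlgHom_apply, under_map_mapAlgEquiv]
  obtain ⟨x, rfl⟩ : ∃ x, f x = x' := ⟨f.symm x', f.apply_symm_apply x'⟩
  have h1 := h x
  rw [MulSemiringAction.toAlgHom_apply] at h1
  have e1 : AlgEquiv.autCongr e φ • f x = f (φ • x) := by
    apply Subtype.ext
    show e (φ (e.symm (e (x : E)))) = e (φ (x : E))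
    rw [e.symm_apply_apply]
  rw [e1, ← map_pow, ← map_sub]
  exact Ideal.mem_map_of_mem _ h1

/-- … and primes above `v` go to primes above `v`. [folklore] -/
theorem map_mapAlgEquiv_mem_primesOver (e : E ≃ₐ[K] E') {v : Ideal (𝓞 K)} {Q : Ideal (𝓞 E)}
    (hQ : Q ∈ v.primesOver (𝓞 E)) :
    Q.map (RingOfIntegers.mapAlgEquiv e) ∈ v.primesOver (𝓞 E') := by
  haveI := hQ.1
  refine ⟨Ideal.map_isPrime_of_equiv _, ⟨?_⟩⟩
  rw [under_map_mapAlgEquiv, hQ.2.over]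

end Transport

/-! ### `(ℤ/p)ˣ = ± γ^{[0,g)}` -/

/-- For a generator `γ` of `(ℤ/p)ˣ`, `p - 1 = 2g`, every `a` is `± γ^i` with `i < g`, and
`γ^i = ±1` only for `i = 0`. [folklore] -/
theorem exists_eq_sign_mul_pow {p : ℕ} [hp : Fact p.Prime] {g : ℕ} (hg : p - 1 = 2 * g) (hg0 : 0 < g)
    {γ : (ZMod p)ˣ} (hγ : ∀ x, x ∈ Subgroup.zpowers γ) (a : (ZMod p)ˣ) :
    ∃ i : ℕ, i < g ∧ (a = γ ^ i ∨ a = -γ ^ i) := by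
  have hcard : Nat.card (ZMod p)ˣ = 2 * g := by
    rw [Nat.card_eq_fintype_card, ZMod.card_units, hg]
  have hord : orderOf γ = 2 * g := by
    rw [orderOf_eq_card_of_forall_mem_zpowers hγ, hcard]
  have hγg : γ ^ g = -1 := by
    have h2 : ((γ ^ g : (ZMod p)ˣ) : ZMod p) * ((γ ^ g : (ZMod p)ˣ) : ZMod p) = 1 := by
      rw [← Units.val_mul, ← pow_add, ← two_mul, ← hord, pow_orderOf_eq_one, Units.val_one]
    rcases mul_self_eq_one_iff.mp h2 with h | h
    · exfalso
      have h1 : γ ^ g = 1 := Units.ext (by rw [h, Units.val_one])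
      have : orderOf γ ≤ g := orderOf_le_of_pow_eq_one hg0 h1
      omega
    · exact Units.ext (by rw [h, Units.val_neg, Units.val_one])
  obtain ⟨j, hj⟩ := Subgroup.mem_zpowers_iff.mp (hγ a)
  -- reduce the exponent modulo `2g`
  have h2g : (0 : ℤ) < ((2 * g : ℕ) : ℤ) := by exact_mod_cast (by omega : 0 < 2 * g)
  set j' : ℕ := (j % ((2 * g : ℕ) : ℤ)).toNat with hj'
  have e1 : ((j' : ℕ) : ℤ) = j % ((2 * g : ℕ) : ℤ) := by
    rw [hj', Int.toNat_of_nonneg (Int.emod_nonneg j h2g.ne')]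
  have hj'lt : j' < 2 * g := by
    have := Int.emod_lt_of_pos j h2g
    zify
    rw [e1]
    exact this
  have hγj' : γ ^ j' = a := by
    rw [← zpow_natCast, e1, show ((2 * g : ℕ) : ℤ) = (orderOf γ : ℤ) by rw [hord],
      zpow_mod_orderOf, hj]
  by_cases hlt : j' < g
  · exact ⟨j', hlt, Or.inl hγj'.symm⟩
  · refine ⟨j' - g, by omega, Or.inr ?_⟩
    have e2 : γ ^ j' = γ ^ (j' - g) * γ ^ g := by rw [← pow_add, Nat.sub_add_cancel (by omega)]
    rw [← hγj', e2, hγg, mul_neg_one]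

/-- `γ^i = ±1` with `i < g` forces `i = 0`. [folklore] -/
theorem eq_zero_of_pow_eq_sign {p : ℕ} [hp : Fact p.Prime] {g : ℕ} (hg : p - 1 = 2 * g)
    {γ : (ZMod p)ˣ} (hγ : ∀ x, x ∈ Subgroup.zpowers γ) {i : ℕ} (hi : i < g)
    (h : γ ^ i = 1 ∨ γ ^ i = -1) : i = 0 := by
  have hcard : Nat.card (ZMod p)ˣ = 2 * g := by
    rw [Nat.card_eq_fintype_card, ZMod.card_units, hg]
  have hord : orderOf γ = 2 * g := by
    rw [orderOf_eq_card_of_forall_mem_zpowers hγ, hcard]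
  have h2 : γ ^ (2 * i) = 1 := by
    rcases h with h | h
    · rw [mul_comm, pow_mul, h, one_pow]
    · rw [mul_comm, pow_mul, h, neg_one_sq]
  have hdvd : 2 * g ∣ 2 * i := by rw [← hord]; exact orderOf_dvd_of_pow_eq_one h2
  have : g ∣ i := Nat.dvd_of_mul_dvd_mul_left (by norm_num) hdvd
  rcases this with ⟨c, rfl⟩
  rcases Nat.eq_zero_or_pos c with h0 | h0
  · rw [h0, mul_zero]
  · exfalso; nlinarith

/-! ### The compositum of the class fields of the characters of `Cl_K`, and the element `h` -/

section ClassField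

variable {K : Type} [Field K] [NumberField K]

omit [NumberField K] in
/-- restriction of `Gal(H'/K)` to a Galois subfield `F ≤ H'` of `K̄`, as automorphisms of `F`
(elementwise: `σ ↦ (x ↦ σ x)`). [folklore] -/
theorem coe_resGal {F H' : IntermediateField K (AlgebraicClosure K)} (hFH : F ≤ H')
    [Normal K (IntermediateField.restrict hFH)] (σ : H' ≃ₐ[K] H') (x : F) :
    ((((AlgEquiv.autCongr (IntermediateField.restrict_algEquiv hFH)).symm
        (AlgEquiv.restrictNormalHom (IntermediateField.restrict hFH) σ)) x : F) : (AlgebraicClosure K)) =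
      ((σ ⟨x, hFH x.2⟩ : H') : (AlgebraicClosure K)) := by
  set e := IntermediateField.restrict_algEquiv hFH with he
  rw [AlgEquiv.autCongr_symm, AlgEquiv.autCongr_apply, AlgEquiv.trans_apply, AlgEquiv.trans_apply,
    AlgEquiv.symm_symm]
  have h1 : ∀ z : IntermediateField.restrict hFH, ((e.symm z : F) : (AlgebraicClosure K)) = ((z : H') : (AlgebraicClosure K)) := by
    intro z
    conv_rhs => rw [← e.apply_symm_apply z]
    rfl
  rw [h1]
  have h2 := AlgEquiv.restrictNormal_commutes σ (IntermediateField.restrict hFH) (e x)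
  change algebraMap (IntermediateField.restrict hFH) H'
      (AlgEquiv.restrictNormalHom (IntermediateField.restrict hFH) σ (e x)) = σ (e x : H') at h2
  have h3 : ((AlgEquiv.restrictNormalHom (IntermediateField.restrict hFH) σ (e x) :
      IntermediateField.restrict hFH) : H') = σ (e x : H') := h2
  rw [h3]
  rfl

/-- **The compositum `H'` of the class fields `E_ψ` (`ψ ∈ Hom(Cl_K, ℂˣ)`) and, for a class `c`,
an element `h ∈ Gal(H'/K)` with `χ_ψ(h|_{E_ψ}) = ψ(c)` for all `ψ`** ([Schoof2009, Lemma 16.2]: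
the Artin symbol of `c` in the Hilbert class field, character by character).  `H'/K` is finite
Galois with abelian group, unramified at every finite prime; the characters `V ψ = χ_ψ ∘ res` of
`Gal(H'/K)` take the value `ψ([v])` on every element that acts on `H'` as an arithmetic Frobenius
above `v` of some finite Galois `Ω ⊇ H'`.  (`h` is a product of Frobenius elements: every class is
a product of classes of primes, `ClassGroup.mem_closure_mk0_prime_not_mem`.)
[cite: Schoof2009, Lemma 16.2 (proof, p. 112)] [cite: NeukirchANT1999, Ch. VI §6 (6.9)] -/
theorem exists_classCompositum (c : ClassGroup (𝓞 K)) :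
    ∃ (H' : IntermediateField K (AlgebraicClosure K)) (_ : FiniteDimensional K H') (_ : IsGalois K H')
      (V : (ClassGroup (𝓞 K) →* ℂˣ) → ((H' ≃ₐ[K] H') →* ℂˣ)) (h : H' ≃ₐ[K] H'),
      (∀ x y : H' ≃ₐ[K] H', Commute x y) ∧
      (∀ v : HeightOneSpectrum (𝓞 K), Algebra.IsUnramifiedIn (𝓞 H') v.asIdeal) ∧
      (∀ ψ, V ψ h = ψ c) ∧
      ∀ (Ω : IntermediateField K (AlgebraicClosure K)) (_ : FiniteDimensional K Ω) (_ : IsGalois K Ω)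
        (hH : H' ≤ Ω) (v : HeightOneSpectrum (𝓞 K)) (Q : Ideal (𝓞 Ω)),
        Q ∈ v.asIdeal.primesOver (𝓞 Ω) → ∀ g : Ω ≃ₐ[K] Ω, IsArithFrobAt (𝓞 K) g Q →
        ∀ g' : H' ≃ₐ[K] H', (∀ x : H', ((g ⟨x, hH x.2⟩ : Ω) : (AlgebraicClosure K)) = ((g' x : H') : (AlgebraicClosure K))) →
        ∀ ψ, V ψ g' = ψ (ClassGroup.mk0 ⟨v.asIdeal, mem_nonZeroDivisors_of_ne_zero v.ne_bot⟩) := by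
  classical
  -- finitely many characters
  haveI : NeZero ((Monoid.exponent (ClassGroup (𝓞 K)) : ℕ) : ℂ) :=
    ⟨Nat.cast_ne_zero.mpr Monoid.exponent_ne_zero_of_finite⟩
  have hcard : Nat.card (ClassGroup (𝓞 K) →* ℂˣ) = Nat.card (ClassGroup (𝓞 K)) :=
    CommGroup.card_monoidHom_of_hasEnoughRootsOfUnity (ClassGroup (𝓞 K)) ℂ
  haveI : Finite (ClassGroup (𝓞 K) →* ℂˣ) :=
    Nat.finite_of_card_ne_zero (by rw [hcard]; exact Nat.card_pos.ne')
  -- the class fields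
  choose E hEfd hEgal χ hE using fun ψ : ClassGroup (𝓞 K) →* ℂˣ => exists_classField_char_frobenius ψ
  haveI : ∀ ψ, FiniteDimensional K (E ψ) := hEfd
  haveI : ∀ ψ, IsGalois K (E ψ) := hEgal
  haveI : ∀ ψ, NumberField (E ψ) := fun ψ => NumberField.of_module_finite K _
  set H' : IntermediateField K (AlgebraicClosure K) := ⨆ ψ, E ψ with hHdef
  haveI : FiniteDimensional K H' := by rw [hHdef]; infer_instance
  haveI : Normal K H' := by rw [hHdef]; infer_instance
  haveI : IsGalois K H' := IsGalois.mk
  haveI : NumberField H' := NumberField.of_module_finite K H'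
  have hle : ∀ ψ, E ψ ≤ H' := fun ψ => by rw [hHdef]; exact le_iSup E ψ
  -- the copies `E' ψ ⊆ H'` and the restrictions
  set E' : (ClassGroup (𝓞 K) →* ℂˣ) → IntermediateField K H' := fun ψ => (E ψ).restrict (hle ψ)
    with hE'def
  set e : ∀ ψ, E ψ ≃ₐ[K] E' ψ := fun ψ => IntermediateField.restrict_algEquiv (hle ψ) with hedef
  haveI : ∀ ψ, IsGalois K (E' ψ) := fun ψ => IsGalois.of_algEquiv (e ψ)
  haveI : ∀ ψ, NumberField (E' ψ) := fun ψ => NumberField.of_module_finite K _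
  set res : ∀ ψ, (H' ≃ₐ[K] H') →* (E ψ ≃ₐ[K] E ψ) := fun ψ =>
    (AlgEquiv.autCongr (e ψ)).symm.toMonoidHom.comp (AlgEquiv.restrictNormalHom (E' ψ)) with hresdef
  have hres : ∀ ψ (σ : H' ≃ₐ[K] H') (x : E ψ),
      ((res ψ σ x : E ψ) : (AlgebraicClosure K)) = ((σ ⟨x, hle ψ x.2⟩ : H') : (AlgebraicClosure K)) := fun ψ σ x =>
    coe_resGal (hle ψ) σ x
  set V : (ClassGroup (𝓞 K) →* ℂˣ) → ((H' ≃ₐ[K] H') →* ℂˣ) := fun ψ => (χ ψ).comp (res ψ) with hVdef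
  -- transported data on `E' ψ`
  have hcomm' : ∀ ψ (a b : E' ψ ≃ₐ[K] E' ψ), Commute a b := by
    intro ψ a b
    obtain ⟨a', rfl⟩ := (AlgEquiv.autCongr (e ψ)).surjective a
    obtain ⟨b', rfl⟩ := (AlgEquiv.autCongr (e ψ)).surjective b
    exact ((hE ψ).1 a' b').map (AlgEquiv.autCongr (e ψ)).toMonoidHom
  have hunr' : ∀ ψ (v : HeightOneSpectrum (𝓞 K)), Algebra.IsUnramifiedIn (𝓞 (E' ψ)) v.asIdeal :=
    fun ψ v => isUnramifiedIn_of_algEquiv (RingOfIntegers.mapAlgEquiv (e ψ).symm) v.ne_bot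
      ((hE ψ).2.2.1 v)
  -- `⨆ E' ψ = ⊤` inside `H'`
  have htop : (⨆ ψ, E' ψ : IntermediateField K H') = ⊤ := by
    apply IntermediateField.lift_injective
    rw [IntermediateField.lift_top]
    show IntermediateField.map H'.val (⨆ ψ, E' ψ) = H'
    rw [IntermediateField.map_iSup]
    conv_rhs => rw [hHdef]
    refine iSup_congr fun ψ => ?_
    exact IntermediateField.lift_restrict (hle ψ)
  -- an automorphism of `H'` trivial on every `E' ψ` is trivial
  have hfaith : ∀ φ : H' ≃ₐ[K] H', (∀ ψ, AlgEquiv.restrictNormalHom (E' ψ) φ = 1) → φ = 1 := by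
    intro φ hφ
    have hfix : ∀ ψ, φ ∈ (E' ψ).fixingSubgroup := fun ψ => by
      rw [IntermediateField.mem_fixingSubgroup_iff]
      intro x hx
      have h2 := AlgEquiv.restrictNormal_commutes φ (E' ψ) ⟨x, hx⟩
      change algebraMap (E' ψ) H' (AlgEquiv.restrictNormalHom (E' ψ) φ ⟨x, hx⟩) = φ x at h2
      rw [hφ ψ, AlgEquiv.one_apply] at h2
      exact h2.symm
    have hle' : (⨆ ψ, E' ψ : IntermediateField K H') ≤
        IntermediateField.fixedField (Subgroup.zpowers φ) := by
      refine iSup_le fun ψ => ?_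
      rw [IntermediateField.le_iff_le, Subgroup.zpowers_le]
      exact hfix ψ
    rw [htop, IntermediateField.le_iff_le, Subgroup.zpowers_le,
      IntermediateField.fixingSubgroup_top, Subgroup.mem_bot] at hle'
    exact hle'
  -- `Gal(H'/K)` is abelian
  have hcommH : ∀ x y : H' ≃ₐ[K] H', Commute x y := by
    intro x y
    have h1 := hfaith (x * y * x⁻¹ * y⁻¹) fun ψ => by
      rw [map_mul, map_mul, map_mul, map_inv, map_inv,
        (hcomm' ψ (AlgEquiv.restrictNormalHom (E' ψ) x) (AlgEquiv.restrictNormalHom (E' ψ) y)).eq,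
        mul_inv_cancel_right, mul_inv_cancel]
    rw [mul_inv_eq_one, mul_inv_eq_iff_eq_mul] at h1
    exact h1
  -- `H'/K` is unramified everywhere
  have hunrH : ∀ v : HeightOneSpectrum (𝓞 K), Algebra.IsUnramifiedIn (𝓞 H') v.asIdeal := by
    intro v
    by_contra hram
    obtain ⟨𝔓, h𝔓, g, hg, hne⟩ := exists_mem_inertia_absRestrictNormalHom_ne_one (L := H') hram
    apply hne
    rw [absRestrictNormalHom_eq_one_iff]
    have hfix : ∀ ψ, Field.absoluteGaloisGroup.toAlgEquiv K g ∈ (E ψ).fixingSubgroup := fun ψ => by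
      rw [← absRestrictNormalHom_eq_one_iff]
      exact absRestrictNormalHom_eq_one_of_isUnramifiedIn (E ψ) ((hE ψ).2.2.1 v) h𝔓 hg
    have hle' : H' ≤ IntermediateField.fixedField
        (Subgroup.zpowers (Field.absoluteGaloisGroup.toAlgEquiv K g)) := by
      rw [hHdef]
      refine iSup_le fun ψ => ?_
      rw [IntermediateField.le_iff_le, Subgroup.zpowers_le]
      exact hfix ψ
    rw [IntermediateField.le_iff_le, Subgroup.zpowers_le] at hle'
    exact hle'
  -- the Frobenius values of `V ψ` on `H'` itself
  have hVfrob : ∀ ψ (v : HeightOneSpectrum (𝓞 K)),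
      V ψ (galFrob K H' v) = ψ (ClassGroup.mk0 ⟨v.asIdeal, mem_nonZeroDivisors_of_ne_zero v.ne_bot⟩) := by
    intro ψ v
    show χ ψ (res ψ (galFrob K H' v)) = _
    have h1 : res ψ (galFrob K H' v) =
        (AlgEquiv.autCongr (e ψ)).symm (galFrob K (E' ψ) v) := by
      show (AlgEquiv.autCongr (e ψ)).symm (AlgEquiv.restrictNormalHom (E' ψ) (galFrob K H' v)) = _
      rw [restrictNormalHom_galFrob_eq_galFrob_of_isUnramifiedIn (hcomm' ψ) (hunr' ψ v)]
    obtain ⟨Q', hQ', hfrob'⟩ := galFrob_spec K (E' ψ) v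
    have h2 := isArithFrobAt_autCongr (e ψ).symm hfrob'
    rw [← AlgEquiv.autCongr_symm] at h2
    rw [h1]
    exact (hE ψ).2.2.2 v _ (map_mapAlgEquiv_mem_primesOver (e ψ).symm hQ') _ h2
  -- the element `h`: induction on the subgroup generated by the classes of primes
  have hgen := Literature.NumberTheory.NumberFields.ClassGroup.mem_closure_mk0_prime_not_mem
    (R := 𝓞 K) ∅ c
  have hP : ∃ h : H' ≃ₐ[K] H', ∀ ψ, V ψ h = ψ c := by
    refine Subgroup.closure_induction (p := fun x _ => ∃ h : H' ≃ₐ[K] H', ∀ ψ, V ψ h = ψ x)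
      ?_ ?_ ?_ ?_ hgen
    · rintro x ⟨v, -, rfl⟩
      exact ⟨galFrob K H' v, fun ψ => hVfrob ψ v⟩
    · exact ⟨1, fun ψ => by rw [map_one, map_one]⟩
    · rintro x y - - ⟨h₁, hh₁⟩ ⟨h₂, hh₂⟩
      exact ⟨h₁ * h₂, fun ψ => by rw [map_mul, map_mul, hh₁, hh₂]⟩
    · rintro x - ⟨h₁, hh₁⟩
      exact ⟨h₁⁻¹, fun ψ => by rw [map_inv, map_inv, hh₁]⟩
  obtain ⟨h, hh⟩ := hP
  refine ⟨H', inferInstance, inferInstance, V, h, hcommH, hunrH, hh, ?_⟩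
  -- the Frobenius property in every `Ω ⊇ H'`
  intro Ω hΩfd hΩgal hH v Q hQ g hg g' hgg' ψ
  haveI := hΩfd
  haveI := hΩgal
  haveI : NumberField Ω := NumberField.of_module_finite K Ω
  have hEΩ : E ψ ≤ Ω := (hle ψ).trans hH
  set EΩ : IntermediateField K Ω := (E ψ).restrict hEΩ with hEΩdef
  set eΩ : E ψ ≃ₐ[K] EΩ := IntermediateField.restrict_algEquiv hEΩ with heΩ
  haveI : IsGalois K EΩ := IsGalois.of_algEquiv eΩ
  haveI : NumberField EΩ := NumberField.of_module_finite K _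
  -- the restriction of `g` to `E ψ` is a Frobenius above `v`
  have hg1 := isArithFrobAt_restrictNormalHom_under (C := EΩ) hg
  have hg2 := isArithFrobAt_autCongr eΩ.symm hg1
  rw [← AlgEquiv.autCongr_symm] at hg2
  have hQ1 : Q.under (𝓞 EΩ) ∈ v.asIdeal.primesOver (𝓞 EΩ) :=
    ArtinConsistency.under_mem_primesOver_of_mem_primesOver hQ
  have hval := (hE ψ).2.2.2 v _ (map_mapAlgEquiv_mem_primesOver eΩ.symm hQ1) _ hg2
  -- and it coincides with the restriction of `g'`
  have heq : res ψ g' = (AlgEquiv.autCongr eΩ).symm (AlgEquiv.restrictNormalHom EΩ g) := by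
    apply AlgEquiv.ext
    intro x
    apply Subtype.ext
    rw [hres ψ g' x, coe_resGal hEΩ g x]
    exact (hgg' ⟨x, hle ψ x.2⟩).symm
  show χ ψ (res ψ g') = _
  rw [heq]
  exact hval

end ClassField

/-! ### [Schoof2009, Lemma 16.2]: the auxiliary primes -/

section AuxPrime

variable {p : ℕ} [hp : Fact p.Prime] {K : Type} [Field K] [NumberField K]
  [hK : IsCyclotomicExtension {p} ℚ K]

open Literature.NumberTheory.NumberFields.Stickelberger
open scoped Pointwise

include hK in
/-- **[Schoof2009, Lemma 16.2] — Thaine's auxiliary primes exist.**  Let `K = ℚ(ζ_p)` (`p` odd,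
`p - 1 = 2g`, `γ` a generator of `G = (ℤ/p)ˣ`), `q ≠ p` an odd prime, and let the `p`-unit
`u₀ = ε π^{m}` satisfy `ι(u₀) = u₀ ρ^q` and have conjugates `σ_{γ^i}(u₀)`, `0 ≤ i < g`, independent
in `K^×/K^{×q}` (the generator of `E/E^q`, [Schoof2009, Prop. 13.7]).  Then for every non-zero
ideal `𝔠` of `𝓞 K` there are a prime `l ≡ 1 (mod p)`, `≡ 1 (mod q)`, and a prime `𝔩 ∣ l` of `K` in
the class of `𝔠` modulo principal ideals and `q`-th powers, such that `u₀` is not a `q`-th power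
modulo `𝔩` but is one modulo `σ_b(𝔩)` for all `b ≠ ±1` — the hypothesis `hAux` of `thaine`.
Proof as printed: Chebotarëv's theorem in `Ω = K(ζ_q, ᵠ√E, H)` for the element constructed in
part IX from the Artin symbol of `[𝔠]` (`exists_classCompositum`) and the character of `E/E^q`
dual to `u₀`, read off through the dictionary of part VI.
[cite: Schoof2009, Lemma 16.2 (pp. 109, 112–113)] [cite: Washington1997, §15.2] -/
theorem exists_auxPrime {q : ℕ} [hq : Fact q.Prime] (hpq : p ≠ q) (hq2 : q ≠ 2)
    {g₀ : ℕ} (hg : p - 1 = 2 * g₀) (hg0 : 0 < g₀) {γ : (ZMod p)ˣ} (hγ : ∀ x, x ∈ Subgroup.zpowers γ)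
    {ζ : K} (hζ : IsPrimitiveRoot ζ p) {u₀ : 𝓞 K} {εu : (𝓞 K)ˣ} {mu : ℕ}
    (hu : u₀ = εu * (hζ.toInteger - 1) ^ mu) (hι : ∃ ρ : 𝓞 K, gal p K (-1) • u₀ = u₀ * ρ ^ q)
    (hind : Literature.FieldTheory.Kummer.IndepModPowers q
      (fun i : Fin g₀ => ((gal p K (γ ^ (i : ℕ)) • u₀ : 𝓞 K) : K)))
    (𝔠 : Ideal (𝓞 K)) (h𝔠 : 𝔠 ≠ ⊥) :
    ∃ (l : ℕ) (_ : Fact l.Prime) (𝔩 : Ideal (𝓞 K)) (_ : 𝔩.IsMaximal)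
      (_ : 𝔩.LiesOver (Ideal.span {(l : ℤ)})),
      p ≠ l ∧ p ∣ l - 1 ∧ q ∣ l - 1 ∧ QRel q 𝔩 𝔠 ∧ (¬ ∃ z : 𝓞 K, u₀ - z ^ q ∈ 𝔩) ∧
      (∀ b : (ZMod p)ˣ, b ≠ 1 → b ≠ -1 →
        ∃ z : 𝓞 K, z ∉ gal p K b • 𝔩 ∧ u₀ - z ^ q ∈ gal p K b • 𝔩) := by
  classical
  haveI : NeZero q := ⟨hq.out.ne_zero⟩
  have hq0 : 0 < q := hq.out.pos
  haveI : Fact (1 < q) := ⟨hq.out.one_lt⟩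
  obtain ⟨ρ, hρ⟩ := hι
  -- the class fields and the Artin symbol of `[𝔠]`
  obtain ⟨H', hH'fd, hH'gal, V, h, hcommH, hunrH, hVh, hVfrob⟩ :=
    exists_classCompositum (K := K) (ClassGroup.mk0 ⟨𝔠, mem_nonZeroDivisors_of_ne_zero h𝔠⟩)
  haveI := hH'fd
  haveI := hH'gal
  -- the Frobenius element of part IX
  set u : Fin g₀ → K := fun i => ((gal p K (γ ^ (i : ℕ)) • u₀ : 𝓞 K) : K) with hudef
  have hπ0 : hζ.toInteger - 1 ≠ 0 := by
    intro h0
    rw [sub_eq_zero] at h0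
    have h1 : (ζ : K) = 1 := by
      simpa [IsPrimitiveRoot.coe_toInteger] using congrArg (fun x : 𝓞 K => (x : K)) h0
    exact hζ.ne_one hp.out.one_lt h1
  have hu00 : u₀ ≠ 0 := by
    rw [hu]; exact mul_ne_zero (Units.ne_zero _) (pow_ne_zero _ hπ0)
  have hu0 : ∀ i, u i ≠ 0 := fun i => by
    rw [hudef]
    simp only [ne_eq, RingOfIntegers.coe_eq_zero_iff]
    exact smul_ne_zero' _ hu00
  set a : Fin g₀ → ZMod q := fun i => if (i : ℕ) = 0 then 1 else 0 with hadef
  have hunrq : ∀ v : HeightOneSpectrum (𝓞 K), ((q : ℕ) : 𝓞 K) ∈ v.asIdeal →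
      Algebra.IsUnramifiedIn (𝓞 H') v.asIdeal := fun v _ => hunrH v
  obtain ⟨ζ', y, Ω, hΩfd, hΩgal, hH, hζΩ, hyΩ, g, hζ', hy, hgζ, hgy, hgh⟩ :=
    exists_frobElt (K := K) hpq hq2 u hu0 hind a H' hcommH hunrq h
  haveI := hΩfd
  haveI := hΩgal
  haveI : NumberField Ω := NumberField.of_module_finite K Ω
  -- Chebotarëv: a degree-one prime `v ∤ pq` with Frobenius `g`
  have hinf := Literature.NumberTheory.NumberFields.infinite_setOf_exists_isArithFrobAt (F := K) (L := Ω) g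
  have hpq0 : (Ideal.span {((p * q : ℕ) : 𝓞 K)} : Ideal (𝓞 K)) ≠ ⊥ := by
    rw [Ne, Ideal.span_singleton_eq_bot]
    exact_mod_cast (Nat.mul_ne_zero hp.out.ne_zero hq.out.ne_zero)
  have hfin : {v : HeightOneSpectrum (𝓞 K) | v.asIdeal ∣ Ideal.span {((p * q : ℕ) : 𝓞 K)}}.Finite :=
    Ideal.finite_factors hpq0
  obtain ⟨v, ⟨hvprime, -, Q, hQ, hfrob⟩, hvpq⟩ := (hinf.sdiff hfin).nonempty
  simp only [Set.mem_setOf_eq] at hvpq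
  have hmem_of : ∀ {m : ℕ}, m ∣ p * q → ((m : ℕ) : 𝓞 K) ∈ v.asIdeal → False := by
    intro m hm hmv
    apply hvpq
    rw [Ideal.dvd_iff_le, Ideal.span_singleton_le_iff_mem]
    obtain ⟨d, hd⟩ := hm
    rw [hd, Nat.cast_mul]
    exact Ideal.mul_mem_right _ _ hmv
  have hp𝔩 : ((p : ℕ) : 𝓞 K) ∉ v.asIdeal := fun hm => hmem_of (Dvd.intro _ rfl) hm
  have hq𝔩 : ((q : ℕ) : 𝓞 K) ∉ v.asIdeal := fun hm => hmem_of (Dvd.intro_left _ rfl) hm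
  haveI := v.isMaximal
  haveI : Q.IsPrime := hQ.1
  haveI : Q.LiesOver v.asIdeal := hQ.2
  -- the class condition
  have hrel : QRel q v.asIdeal 𝔠 := by
    refine QRel.of_forall_char v.ne_bot h𝔠 fun ψ _ => ?_
    rw [← hVh ψ]
    exact (hVfrob Ω inferInstance inferInstance hH v Q hQ g hfrob h hgh ψ).symm
  -- the Kummer data inside `𝓞 Ω`
  set ζΩ : Ω := ⟨ζ', hζΩ⟩ with hζΩdef
  have hζΩp : IsPrimitiveRoot ζΩ q := IsPrimitiveRoot.coe_submonoidClass_iff.mp hζ'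
  set ζq : 𝓞 Ω := ⟨ζΩ, hζΩp.isIntegral hq0⟩ with hζqdef
  have hζq : IsPrimitiveRoot (ζq : Ω) q := hζΩp
  set yΩ : Fin g₀ → Ω := fun i => ⟨y i, hyΩ i⟩ with hyΩdef
  have hyΩq : ∀ i, yΩ i ^ q = algebraMap (𝓞 K) Ω (gal p K (γ ^ (i : ℕ)) • u₀) := fun i => by
    apply Subtype.ext
    show ((yΩ i ^ q : Ω) : (AlgebraicClosure K)) = _
    rw [SubmonoidClass.coe_pow]
    exact hy i
  haveI : IsScalarTower ℤ (𝓞 K) Ω := IsScalarTower.of_algebraMap_eq' (RingHom.ext_int _ _)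
  have hyint : ∀ i, IsIntegral ℤ (yΩ i) := fun i => by
    refine IsIntegral.of_pow hq0 ?_
    rw [hyΩq]
    exact (RingOfIntegers.isIntegral _).algebraMap
  set yO : Fin g₀ → 𝓞 Ω := fun i => ⟨yΩ i, hyint i⟩ with hyOdef
  have hyOq : ∀ i, yO i ^ q = algebraMap (𝓞 K) (𝓞 Ω) (gal p K (γ ^ (i : ℕ)) • u₀) := fun i => by
    apply Subtype.ext
    exact hyΩq i
  -- the action of `g`
  have hgyO : ∀ i, g • yO i = ζq ^ (a i).val * yO i := fun i => by
    apply Subtype.ext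
    apply Subtype.ext
    show ((g (yΩ i) : Ω) : (AlgebraicClosure K)) = (((ζq ^ (a i).val * yO i : 𝓞 Ω) : Ω) : (AlgebraicClosure K))
    rw [hgy i]
    rfl
  have hgζq : g • ζq = ζq := by
    apply Subtype.ext
    apply Subtype.ext
    exact hgζ
  -- `α_a` for all `a = ± γ^i`
  choose idx hidx hidx' using fun b : (ZMod p)ˣ => exists_eq_sign_mul_pow hg hg0 hγ b
  set ρ' : (ZMod p)ˣ → 𝓞 Ω := fun b => algebraMap (𝓞 K) (𝓞 Ω) (gal p K (γ ^ idx b) • ρ) with hρ'def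
  set α : (ZMod p)ˣ → 𝓞 Ω := fun b =>
    if b = γ ^ idx b then yO ⟨idx b, hidx b⟩ else yO ⟨idx b, hidx b⟩ * ρ' b with hαdef
  have hα : ∀ b, α b ^ q = algebraMap (𝓞 K) (𝓞 Ω) (gal p K b • u₀) := by
    intro b
    by_cases hb : b = γ ^ idx b
    · rw [hαdef]; simp only [if_pos hb]
      rw [hyOq]
      exact congrArg _ (by rw [← hb])
    · have hb' : b = -γ ^ idx b := (hidx' b).resolve_left hb
      rw [hαdef]; simp only [if_neg hb]
      rw [mul_pow, hyOq, hρ'def, ← map_pow, ← map_mul]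
      congr 1
      conv_rhs => rw [hb', ← mul_neg_one, gal_mul, mul_smul, hρ]
      rw [smul_mul', smul_pow']
  have hsign : ∀ b, (b = 1 ∨ b = -1) ↔ idx b = 0 := by
    intro b
    constructor
    · intro hb1
      apply eq_zero_of_pow_eq_sign hg hγ (hidx b)
      rcases hidx' b with hb | hb
      · rw [← hb]; exact hb1
      · rw [hb] at hb1
        rcases hb1 with h1 | h1
        · right; rw [← neg_neg (γ ^ idx b), h1]
        · left; exact neg_injective h1
    · intro h0
      rcases hidx' b with hb | hb
      · left; rw [hb, h0, pow_zero]
      · right; rw [hb, h0, pow_zero]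
  have haval : ∀ b, (a ⟨idx b, hidx b⟩).val = if b = 1 ∨ b = -1 then 1 else 0 := by
    intro b
    rw [hadef]
    simp only
    by_cases h0 : idx b = 0
    · rw [if_pos h0, if_pos ((hsign b).mpr h0), ZMod.val_one]
    · rw [if_neg h0, if_neg (fun h1 => h0 ((hsign b).mp h1)), ZMod.val_zero]
  have hgα : ∀ b, g • α b = ζq ^ (if b = 1 ∨ b = -1 then 1 else 0) * α b := by
    intro b
    rw [← haval b]
    by_cases hb : b = γ ^ idx b
    · rw [hαdef]; simp only [if_pos hb]
      exact hgyO _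
    · rw [hαdef]; simp only [if_neg hb]
      rw [smul_mul', hgyO, hρ'def, smul_algebraMap, mul_assoc]
  -- conclude with the dictionary of part VI
  exact auxPrime_of_isArithFrobAt (K := K) (Ω := Ω) hq.out hζ hu v.asIdeal hvprime hp𝔩 hq𝔩 hrel hζq
    hα hgζq hgα Q hfrob

include hK in
/-- **Thaine's theorem for `ℚ(ζ_p)` [Schoof2009, Theorem 16.3] (F. Thaine, 1988), with the auxiliary
primes supplied by [Schoof2009, Lemma 16.2] (`exists_auxPrime`).**  Let `p` be an odd prime,
`p - 1 = 2g`, `γ` a generator of `G = Gal(ℚ(ζ_p)/ℚ) = (ℤ/p)ˣ`, `q ≠ p` an odd prime, and let the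
`p`-unit `u₀ = ε π^m` (`π = ζ_p - 1`) satisfy `ι(u₀) = u₀ ρ^q` and have conjugates `σ_{γ^i}(u₀)`,
`0 ≤ i < g`, independent modulo `q`-th powers (a generator of the free rank-one `𝔽_q[G⁺]`-module
`E/E^q`, [Schoof2009, Prop. 13.7]).  If the symmetric `θ = ∑_b t_b σ_b ∈ ℕ[G]` annihilates `u₀`
modulo cyclotomic units and `q`-th powers of `p`-units (`H`), then **`θ` annihilates the class of
`𝔠 · ι(𝔠)` in `Cl_K/Cl_K^q` for every non-zero ideal `𝔠`**: `∏_b σ_b(𝔠 ι𝔠)^{t_b}` is a non-zero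
principal ideal times the `q`-th power of a non-zero ideal (`AnnIdeal`).  Every `ι`-invariant class
modulo `q`-th powers being of the form `[𝔠 · ι𝔠]`, this is "`θ` annihilates `Cl⁺/Cl⁺^q`".
[cite: Schoof2009, Theorem 16.3 with Lemma 16.2 (pp. 109–113)] [cite: Washington1997, Thm. 15.2] -/
theorem thaine_main {q : ℕ} [hq : Fact q.Prime] (hpq : p ≠ q) (hq2 : q ≠ 2)
    {g₀ : ℕ} (hg : p - 1 = 2 * g₀) (hg0 : 0 < g₀) {γ : (ZMod p)ˣ} (hγ : ∀ x, x ∈ Subgroup.zpowers γ)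
    {ζ : K} (hζ : IsPrimitiveRoot ζ p) {t : (ZMod p)ˣ → ℕ} (ht : ∀ b, t (-b) = t b)
    {u₀ : 𝓞 K} {εu : (𝓞 K)ˣ} {mu : ℕ} (hu : u₀ = εu * (hζ.toInteger - 1) ^ mu)
    (hι : ∃ ρ : 𝓞 K, gal p K (-1) • u₀ = u₀ * ρ ^ q)
    (hind : Literature.FieldTheory.Kummer.IndepModPowers q
      (fun i : Fin g₀ => ((gal p K (γ ^ (i : ℕ)) • u₀ : 𝓞 K) : K)))
    {εv εw : (𝓞 K)ˣ} {mv mw e₀ e₁ : ℕ} {n : (ZMod p)ˣ → ℕ}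
    (H : galPow t u₀ * ((εw : 𝓞 K) * (hζ.toInteger - 1) ^ mw) ^ q =
      cycElt hζ e₀ e₁ n * ((εv : 𝓞 K) * (hζ.toInteger - 1) ^ mv) ^ q) :
    ∀ 𝔠 : Ideal (𝓞 K), 𝔠 ≠ ⊥ → AnnIdeal q (𝔠 * gal p K (-1) • 𝔠) t := by
  have hp2 : p ≠ 2 := by
    intro h2
    rw [h2] at hg
    omega
  exact thaine (K := K) hp2 hq.out hq2 hζ ht hu hι H
    (fun 𝔠 h𝔠 => exists_auxPrime (K := K) hpq hq2 hg hg0 hγ hζ hu hι hind 𝔠 h𝔠)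

end AuxPrime

end Catalan.Thaine

end Literature.NumberTheory.DiophantineGeometry
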